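import Literature.MathematicalPhysics.QuantumLattice.FreeDWaveBdGCanonicalEnergy
import Mathlib.Analysis.Convex.Slope
import HarnessLib

/-!
# The free `d`-wave-sourced BdG canonical energy is CONCAVE in the source; the free gain `G₀` is CONVEX

Topic `MathematicalPhysics/QuantumLattice`, family `hubbard` (cell `hubbard-cq`). Companion to
`FreeDWaveBdGCanonicalEnergy.lean` (the kinematic comparator `G₀(t′; n, h) = e_free(t′, n, 0) − e_free(t′, n, h)`
of the pinning-field gain words). That file proves that `e_free(n, ·)` is even and antitone in `|h|` and that
`G₀` is monotone in `|h|`, so an interval certificate of `G₀` at one grid field propagates one-sidedly along the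
field axis. This file adds the second elementary shape fact, the one that lets a FINITE grid of certified cells
speak for every field BETWEEN and BEYOND grid points:

* §1 For every momentum `p` the BdG quasiparticle energy `E = √((ε(p) − μ)² + Δ̂_h(p)²)` is JOINTLY CONVEX in
  the pair `(μ, h)` — it is the Euclidean norm of the affine map `(μ, h) ↦ (ε(p) − μ, 2√2(cos p₀ − cos p₁)·h)` —
  so the pair-block level `ξ − E` is jointly concave (`freeBdGLevel_convexComb_le`).
* §2 Integrating over the zone: the grand potential `Ω(t′, μ, h)` and the Legendre functional `Ω + μn` are
  jointly concave in `(μ, h)` (`freeBdGGrandPotential_convexComb_le`, `concaveOn_freeBdGGrandPotential`).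
* §3 Partial maximisation over `μ` of a jointly concave function is concave (Boyd–Vandenberghe §3.2.5, the
  concave/`sup` form of the minimisation rule; Rockafellar Thm. 5.7): for `0 ≤ n ≤ 2` (where the supremum is of a
  bounded family) the CANONICAL energy `e_free(t′, n, ·) = ⨆_μ (Ω(μ, ·) + μn)` is CONCAVE on `ℝ`
  (`concaveOn_freeBdGCanonicalEnergy`) and the gain `G₀(t′, n, ·)` is CONVEX on `ℝ` (`convexOn_freeBdGGain`).
  This is the `U = 0`, thermodynamic-limit instance of the concavity of a sourced ground-state energy in its
  source (Koma–Tasaki 1994 §1), here obtained from the explicit BdG formula rather than from a variational principle.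
* §4 Readers for certificate consumers (`0 ≤ n ≤ 2`): the CHORD UPPER bound between two grid fields
  (`freeBdGGain_convexComb_le`, `freeBdGGain_le_chord_of_le`) and the SECANT-EXTENSION LOWER bounds beyond two grid
  fields (`freeBdGGain_secant_ge_of_bounds` to the right of a pair `c < a`, `freeBdGGain_secant_ge_of_bounds'` to
  the left of a pair `b < d`): a certified upper end at `c` and a certified lower end at `a` bound `G₀` from BELOW
  at every `h ≥ a` by the extended secant. With these, finitely many interval cells give two-sided affine envelopes
  of `G₀` on whole field intervals.

HONEST SCOPE. Elementary real analysis on the DEFINITIONS of `FreeDWaveBdGCanonicalEnergy.lean`; no number is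
asserted; a comparator of the non-interacting problem is never a bound on a `U > 0` object. Everything here is
proved; no named fact is introduced.

## References
* S. Boyd, L. Vandenberghe, *Convex Optimization* (CUP 2004), §3.2.5 (partial minimisation preserves convexity)
  and §3.1.5 (norms are convex). [cite: BoydVandenberghe2004, §3.2.5]
* R. T. Rockafellar, *Convex Analysis* (Princeton 1970), Thm. 5.7. [cite: Rockafellar1970, Thm. 5.7]
* V. Bach, E. H. Lieb, J. P. Solovej, J. Stat. Phys. 76 (1994) 3–89, §2b (2b.37)–(2b.39), §3.
  [cite: BachLiebSolovej1994, §3]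
* T. Koma, H. Tasaki, J. Stat. Phys. 76 (1994) 745–803, §1 (concavity of the sourced energy in the source).
  [cite: KomaTasaki1994, §1]
-/

noncomputable section

namespace Literature.MathematicalPhysics.QuantumLattice

open Real MeasureTheory Set Literature.Probability.LatticeModels

/-! ### §1 Pointwise: the quasiparticle energy is jointly convex in `(μ, h)` -/

/-- Convexity of the Euclidean norm of `ℝ²` along a segment, in coordinates: for weights `a, b ≥ 0`,
`√((a u₁ + b u₂)² + (a v₁ + b v₂)²) ≤ a √(u₁² + v₁²) + b √(u₂² + v₂²)` (Minkowski / Cauchy–Schwarz in the plane).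
[cite: BoydVandenberghe2004, §3.1.5] -/
theorem sqrt_sq_add_sq_convexComb_le {a b : ℝ} (ha : 0 ≤ a) (hb : 0 ≤ b) (u₁ v₁ u₂ v₂ : ℝ) :
    Real.sqrt ((a * u₁ + b * u₂) ^ 2 + (a * v₁ + b * v₂) ^ 2) ≤
      a * Real.sqrt (u₁ ^ 2 + v₁ ^ 2) + b * Real.sqrt (u₂ ^ 2 + v₂ ^ 2) := by
  set r₁ := Real.sqrt (u₁ ^ 2 + v₁ ^ 2) with hr₁
  set r₂ := Real.sqrt (u₂ ^ 2 + v₂ ^ 2) with hr₂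
  have hr₁0 : 0 ≤ r₁ := Real.sqrt_nonneg _
  have hr₂0 : 0 ≤ r₂ := Real.sqrt_nonneg _
  have h1 : r₁ ^ 2 = u₁ ^ 2 + v₁ ^ 2 := Real.sq_sqrt (by positivity)
  have h2 : r₂ ^ 2 = u₂ ^ 2 + v₂ ^ 2 := Real.sq_sqrt (by positivity)
  have hCS : u₁ * u₂ + v₁ * v₂ ≤ r₁ * r₂ := by
    have hsq : (u₁ * u₂ + v₁ * v₂) ^ 2 ≤ (r₁ * r₂) ^ 2 := by
      rw [mul_pow, h1, h2]
      nlinarith [sq_nonneg (u₁ * v₂ - u₂ * v₁)]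
    exact le_of_sq_le_sq hsq (mul_nonneg hr₁0 hr₂0)
  have hY : 0 ≤ a * r₁ + b * r₂ := by positivity
  rw [Real.sqrt_le_left hY]
  have hab : 0 ≤ a * b := mul_nonneg ha hb
  have e1 : a ^ 2 * r₁ ^ 2 = a ^ 2 * (u₁ ^ 2 + v₁ ^ 2) := by rw [h1]
  have e2 : b ^ 2 * r₂ ^ 2 = b ^ 2 * (u₂ ^ 2 + v₂ ^ 2) := by rw [h2]
  nlinarith [mul_le_mul_of_nonneg_left hCS hab, e1, e2]

/-- **The BdG quasiparticle energy is jointly convex in `(μ, h)`** at every momentum: for `a, b ≥ 0`, `a + b = 1`,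
`E(t′, aμ₁ + bμ₂, ah₁ + bh₂; p) ≤ a·E(t′, μ₁, h₁; p) + b·E(t′, μ₂, h₂; p)` — the Euclidean norm of the affine map
`(μ, h) ↦ (ε(p) − μ, 2√2(cos p₀ − cos p₁)·h)`. [cite: BachLiebSolovej1994, §2b (2b.37)–(2b.39)] -/
theorem freeBdGEnergy_convexComb_le (tp : ℝ) {a b : ℝ} (ha : 0 ≤ a) (hb : 0 ≤ b) (hab : a + b = 1)
    (μ₁ μ₂ h₁ h₂ : ℝ) (p : Fin 2 → ℝ) :
    freeBdGEnergy tp (a * μ₁ + b * μ₂) (a * h₁ + b * h₂) p ≤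
      a * freeBdGEnergy tp μ₁ h₁ p + b * freeBdGEnergy tp μ₂ h₂ p := by
  have key := sqrt_sq_add_sq_convexComb_le ha hb (freeBandTT' tp p - μ₁) (freeBdGGap h₁ p)
    (freeBandTT' tp p - μ₂) (freeBdGGap h₂ p)
  have e1 : a * (freeBandTT' tp p - μ₁) + b * (freeBandTT' tp p - μ₂) =
      freeBandTT' tp p - (a * μ₁ + b * μ₂) := by
    linear_combination (freeBandTT' tp p) * hab
  have e2 : a * freeBdGGap h₁ p + b * freeBdGGap h₂ p = freeBdGGap (a * h₁ + b * h₂) p := by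
    unfold freeBdGGap; ring
  rw [e1, e2] at key
  unfold freeBdGEnergy
  exact key

/-- **The pair-block level `ξ − E` is jointly concave in `(μ, h)`** at every momentum: for `a, b ≥ 0`, `a + b = 1`,
`a·ℓ(μ₁, h₁; p) + b·ℓ(μ₂, h₂; p) ≤ ℓ(aμ₁ + bμ₂, ah₁ + bh₂; p)` (the `ξ`-part is affine, `E` is jointly convex).
[cite: BachLiebSolovej1994, §2b (2b.37)–(2b.39)] -/
theorem freeBdGLevel_convexComb_le (tp : ℝ) {a b : ℝ} (ha : 0 ≤ a) (hb : 0 ≤ b) (hab : a + b = 1)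
    (μ₁ μ₂ h₁ h₂ : ℝ) (p : Fin 2 → ℝ) :
    a * freeBdGLevel tp μ₁ h₁ p + b * freeBdGLevel tp μ₂ h₂ p ≤
      freeBdGLevel tp (a * μ₁ + b * μ₂) (a * h₁ + b * h₂) p := by
  have key := freeBdGEnergy_convexComb_le tp ha hb hab μ₁ μ₂ h₁ h₂ p
  unfold freeBdGLevel
  have e1 : a * (freeBandTT' tp p - μ₁) + b * (freeBandTT' tp p - μ₂) =
      freeBandTT' tp p - (a * μ₁ + b * μ₂) := by
    linear_combination (freeBandTT' tp p) * hab
  linarith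

/-! ### §2 Zone averages: the grand potential and the Legendre functional are jointly concave in `(μ, h)` -/

/-- **The free BdG grand potential is jointly concave in `(μ, h)`**: for `a, b ≥ 0`, `a + b = 1`,
`a·Ω(t′, μ₁, h₁) + b·Ω(t′, μ₂, h₂) ≤ Ω(t′, aμ₁ + bμ₂, ah₁ + bh₂)` (integrate the pointwise inequality over the zone).
[cite: BachLiebSolovej1994, §3] -/
theorem freeBdGGrandPotential_convexComb_le (tp : ℝ) {a b : ℝ} (ha : 0 ≤ a) (hb : 0 ≤ b) (hab : a + b = 1)
    (μ₁ μ₂ h₁ h₂ : ℝ) :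
    a * freeBdGGrandPotential tp μ₁ h₁ + b * freeBdGGrandPotential tp μ₂ h₂ ≤
      freeBdGGrandPotential tp (a * μ₁ + b * μ₂) (a * h₁ + b * h₂) := by
  have hI₁ := integrableOn_freeBdGLevel tp μ₁ h₁
  have hI₂ := integrableOn_freeBdGLevel tp μ₂ h₂
  have hI₃ := integrableOn_freeBdGLevel tp (a * μ₁ + b * μ₂) (a * h₁ + b * h₂)
  have hIab : IntegrableOn (fun p : Fin 2 → ℝ => a * freeBdGLevel tp μ₁ h₁ p + b * freeBdGLevel tp μ₂ h₂ p)
      (brillouin 2) volume := (hI₁.const_mul a).add (hI₂.const_mul b)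
  have hmono : ∫ p in brillouin 2, (a * freeBdGLevel tp μ₁ h₁ p + b * freeBdGLevel tp μ₂ h₂ p) ≤
      ∫ p in brillouin 2, freeBdGLevel tp (a * μ₁ + b * μ₂) (a * h₁ + b * h₂) p :=
    setIntegral_mono_on hIab hI₃ (measurableSet_brillouin 2)
      fun p _ => freeBdGLevel_convexComb_le tp ha hb hab μ₁ μ₂ h₁ h₂ p
  have hsplit : ∫ p in brillouin 2, (a * freeBdGLevel tp μ₁ h₁ p + b * freeBdGLevel tp μ₂ h₂ p) =
      a * (∫ p in brillouin 2, freeBdGLevel tp μ₁ h₁ p) + b * (∫ p in brillouin 2, freeBdGLevel tp μ₂ h₂ p) := by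
    rw [integral_add (hI₁.const_mul a) (hI₂.const_mul b), integral_const_mul, integral_const_mul]
  have hπ : (0 : ℝ) ≤ ((2 * π) ^ 2)⁻¹ := inv_nonneg.2 (by positivity)
  unfold freeBdGGrandPotential
  have := mul_le_mul_of_nonneg_left (hsplit.symm.le.trans hmono) hπ
  linarith [this]

/-- `ConcaveOn` form: `(μ, h) ↦ Ω(t′, μ, h)` is concave on `ℝ × ℝ`. [cite: BachLiebSolovej1994, §3] -/
theorem concaveOn_freeBdGGrandPotential (tp : ℝ) :
    ConcaveOn ℝ Set.univ (fun x : ℝ × ℝ => freeBdGGrandPotential tp x.1 x.2) := by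
  refine ⟨convex_univ, ?_⟩
  intro x _ y _ a b ha hb hab
  simp only [smul_eq_mul, Prod.fst_add, Prod.snd_add, Prod.smul_fst, Prod.smul_snd]
  exact freeBdGGrandPotential_convexComb_le tp ha hb hab x.1 y.1 x.2 y.2

/-- **The Legendre functional `Ω(t′, μ, h) + μn` is jointly concave in `(μ, h)`**: for `a, b ≥ 0`, `a + b = 1`,
`a·φ(μ₁; h₁) + b·φ(μ₂; h₂) ≤ φ(aμ₁ + bμ₂; ah₁ + bh₂)` (the `μn` part is affine). [cite: BachLiebSolovej1994, §3] -/
theorem freeBdGLegendre_convexComb_le (tp n : ℝ) {a b : ℝ} (ha : 0 ≤ a) (hb : 0 ≤ b) (hab : a + b = 1)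
    (μ₁ μ₂ h₁ h₂ : ℝ) :
    a * freeBdGLegendre tp n h₁ μ₁ + b * freeBdGLegendre tp n h₂ μ₂ ≤
      freeBdGLegendre tp n (a * h₁ + b * h₂) (a * μ₁ + b * μ₂) := by
  have key := freeBdGGrandPotential_convexComb_le tp ha hb hab μ₁ μ₂ h₁ h₂
  unfold freeBdGLegendre
  linarith

/-! ### §3 The canonical energy is concave in the source; the gain is convex -/

/-- **Concavity of the canonical energy in the source (two-point form)**: for `0 ≤ n ≤ 2` and `a, b ≥ 0`,
`a + b = 1`, `a·e_free(t′, n, h₁) + b·e_free(t′, n, h₂) ≤ e_free(t′, n, ah₁ + bh₂)` — partial maximisation over `μ`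
of the jointly concave Legendre functional: `aφ(μ₁; h₁) + bφ(μ₂; h₂) ≤ φ(aμ₁ + bμ₂; ah₁ + bh₂) ≤ e_free(ah₁ + bh₂)`
for all `μ₁, μ₂`, then two suprema. [cite: BoydVandenberghe2004, §3.2.5] -/
theorem freeBdGCanonicalEnergy_convexComb_le {n : ℝ} (hn0 : 0 ≤ n) (hn2 : n ≤ 2) (tp : ℝ) {a b : ℝ}
    (ha : 0 ≤ a) (hb : 0 ≤ b) (hab : a + b = 1) (h₁ h₂ : ℝ) :
    a * freeBdGCanonicalEnergy tp n h₁ + b * freeBdGCanonicalEnergy tp n h₂ ≤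
      freeBdGCanonicalEnergy tp n (a * h₁ + b * h₂) := by
  have hpt : ∀ μ₁ μ₂ : ℝ, a * freeBdGLegendre tp n h₁ μ₁ + b * freeBdGLegendre tp n h₂ μ₂ ≤
      freeBdGCanonicalEnergy tp n (a * h₁ + b * h₂) := fun μ₁ μ₂ =>
    (freeBdGLegendre_convexComb_le tp n ha hb hab μ₁ μ₂ h₁ h₂).trans
      (freeBdGLegendre_le_canonicalEnergy hn0 hn2 tp (a * h₁ + b * h₂) (a * μ₁ + b * μ₂))
  have hA : a * freeBdGCanonicalEnergy tp n h₁ = ⨆ μ₁ : ℝ, a * freeBdGLegendre tp n h₁ μ₁ := by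
    unfold freeBdGCanonicalEnergy
    exact Real.mul_iSup_of_nonneg ha _
  have hB : b * freeBdGCanonicalEnergy tp n h₂ = ⨆ μ₂ : ℝ, b * freeBdGLegendre tp n h₂ μ₂ := by
    unfold freeBdGCanonicalEnergy
    exact Real.mul_iSup_of_nonneg hb _
  rw [← le_sub_iff_add_le, hA]
  refine ciSup_le fun μ₁ => ?_
  rw [le_sub_iff_add_le, add_comm, ← le_sub_iff_add_le, hB]
  refine ciSup_le fun μ₂ => ?_
  rw [le_sub_iff_add_le, add_comm]
  exact hpt μ₁ μ₂

/-- **The free BdG canonical energy is CONCAVE in the source**: for `0 ≤ n ≤ 2`,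
`ConcaveOn ℝ univ (e_free(t′, n, ·))`. The `U = 0`, thermodynamic-limit instance of the concavity of a sourced
ground-state energy in its source. [cite: KomaTasaki1994, §1] -/
theorem concaveOn_freeBdGCanonicalEnergy {n : ℝ} (hn0 : 0 ≤ n) (hn2 : n ≤ 2) (tp : ℝ) :
    ConcaveOn ℝ Set.univ (freeBdGCanonicalEnergy tp n) := by
  refine ⟨convex_univ, ?_⟩
  intro x _ y _ a b ha hb hab
  simp only [smul_eq_mul]
  exact freeBdGCanonicalEnergy_convexComb_le hn0 hn2 tp ha hb hab x y

/-- **The free gain is CONVEX in the source (two-point form)**: for `0 ≤ n ≤ 2`, `a, b ≥ 0`, `a + b = 1`,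
`G₀(t′, n, ah₁ + bh₂) ≤ a·G₀(t′, n, h₁) + b·G₀(t′, n, h₂)`. [cite: KomaTasaki1994, §1] -/
theorem freeBdGGain_convexComb_le {n : ℝ} (hn0 : 0 ≤ n) (hn2 : n ≤ 2) (tp : ℝ) {a b : ℝ}
    (ha : 0 ≤ a) (hb : 0 ≤ b) (hab : a + b = 1) (h₁ h₂ : ℝ) :
    freeBdGGain tp n (a * h₁ + b * h₂) ≤ a * freeBdGGain tp n h₁ + b * freeBdGGain tp n h₂ := by
  have key := freeBdGCanonicalEnergy_convexComb_le hn0 hn2 tp ha hb hab h₁ h₂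
  simp only [freeBdGGain_def]
  have e0 : freeBdGCanonicalEnergy tp n 0 = a * freeBdGCanonicalEnergy tp n 0 + b * freeBdGCanonicalEnergy tp n 0 := by
    rw [← add_mul, hab, one_mul]
  linarith

/-- **The free gain is CONVEX in the source**: for `0 ≤ n ≤ 2`, `ConvexOn ℝ univ (G₀(t′, n, ·))`.
[cite: KomaTasaki1994, §1] -/
theorem convexOn_freeBdGGain {n : ℝ} (hn0 : 0 ≤ n) (hn2 : n ≤ 2) (tp : ℝ) :
    ConvexOn ℝ Set.univ (freeBdGGain tp n) := by
  refine ⟨convex_univ, ?_⟩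
  intro x _ y _ a b ha hb hab
  simp only [smul_eq_mul]
  exact freeBdGGain_convexComb_le hn0 hn2 tp ha hb hab x y

/-! ### §4 Readers: chord ceilings between grid fields, secant-extension floors beyond them -/

/-- **CHORD CEILING between two grid fields**: certified upper ends `G₀(h₁) ≤ C₁`, `G₀(h₂) ≤ C₂` give
`G₀(ah₁ + bh₂) ≤ aC₁ + bC₂` for `a, b ≥ 0`, `a + b = 1` (`0 ≤ n ≤ 2`). [cite: BoydVandenberghe2004, §3.2.5] -/
theorem freeBdGGain_le_chord_of_le {n : ℝ} (hn0 : 0 ≤ n) (hn2 : n ≤ 2) {tp a b h₁ h₂ C₁ C₂ : ℝ}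
    (ha : 0 ≤ a) (hb : 0 ≤ b) (hab : a + b = 1) (hC₁ : freeBdGGain tp n h₁ ≤ C₁)
    (hC₂ : freeBdGGain tp n h₂ ≤ C₂) : freeBdGGain tp n (a * h₁ + b * h₂) ≤ a * C₁ + b * C₂ :=
  (freeBdGGain_convexComb_le hn0 hn2 tp ha hb hab h₁ h₂).trans
    (by nlinarith [mul_le_mul_of_nonneg_left hC₁ ha, mul_le_mul_of_nonneg_left hC₂ hb])

/-- **Three-point secant inequality** (Mathlib `ConvexOn.secant_mono_aux1` for `G₀`): for `x < y < z`,
`(z − x)·G₀(y) ≤ (z − y)·G₀(x) + (y − x)·G₀(z)` (`0 ≤ n ≤ 2`). [cite: Rockafellar1970, Thm. 5.7] -/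
theorem freeBdGGain_secant_aux {n : ℝ} (hn0 : 0 ≤ n) (hn2 : n ≤ 2) (tp : ℝ) {x y z : ℝ} (hxy : x < y)
    (hyz : y < z) : (z - x) * freeBdGGain tp n y ≤ (z - y) * freeBdGGain tp n x + (y - x) * freeBdGGain tp n z :=
  (convexOn_freeBdGGain hn0 hn2 tp).secant_mono_aux1 (Set.mem_univ x) (Set.mem_univ z) hxy hyz

/-- **SECANT-EXTENSION FLOOR to the RIGHT of a certified pair** (`0 ≤ n ≤ 2`): grid fields `c < a`, a certified
UPPER end `G₀(c) ≤ C` and a certified LOWER end `A ≤ G₀(a)` bound the gain from below at every `h ≥ a` by the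
secant through `(c, C)`, `(a, A)` extended: `(a − c)·G₀(h) ≥ (h − c)·A − (h − a)·C`, i.e.
`G₀(h) ≥ A + (A − C)(h − a)/(a − c)`. [cite: Rockafellar1970, Thm. 5.7] -/
theorem freeBdGGain_secant_ge_of_bounds {n : ℝ} (hn0 : 0 ≤ n) (hn2 : n ≤ 2) {tp c a h C A : ℝ}
    (hca : c < a) (hah : a ≤ h) (hC : freeBdGGain tp n c ≤ C) (hA : A ≤ freeBdGGain tp n a) :
    (h - c) * A - (h - a) * C ≤ (a - c) * freeBdGGain tp n h := by
  rcases eq_or_lt_of_le hah with rfl | hah'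
  · have : (a - c) * A ≤ (a - c) * freeBdGGain tp n a := mul_le_mul_of_nonneg_left hA (by linarith)
    linarith
  · have key := freeBdGGain_secant_aux hn0 hn2 tp hca hah'
    have h1 : (h - c) * A ≤ (h - c) * freeBdGGain tp n a := mul_le_mul_of_nonneg_left hA (by linarith)
    have h2 : (h - a) * freeBdGGain tp n c ≤ (h - a) * C := mul_le_mul_of_nonneg_left hC (by linarith)
    linarith

/-- **SECANT-EXTENSION FLOOR to the LEFT of a certified pair** (`0 ≤ n ≤ 2`): grid fields `b < d`, a certified
LOWER end `B ≤ G₀(b)` and a certified UPPER end `G₀(d) ≤ D` bound the gain from below at every `h ≤ b`: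
`(d − b)·G₀(h) ≥ (d − h)·B − (b − h)·D`, i.e. `G₀(h) ≥ B − (D − B)(b − h)/(d − b)`.
[cite: Rockafellar1970, Thm. 5.7] -/
theorem freeBdGGain_secant_ge_of_bounds' {n : ℝ} (hn0 : 0 ≤ n) (hn2 : n ≤ 2) {tp h b d B D : ℝ}
    (hhb : h ≤ b) (hbd : b < d) (hB : B ≤ freeBdGGain tp n b) (hD : freeBdGGain tp n d ≤ D) :
    (d - h) * B - (b - h) * D ≤ (d - b) * freeBdGGain tp n h := by
  rcases eq_or_lt_of_le hhb with rfl | hhb'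
  · have : (d - h) * B ≤ (d - h) * freeBdGGain tp n h := mul_le_mul_of_nonneg_left hB (by linarith)
    linarith
  · have key := freeBdGGain_secant_aux hn0 hn2 tp hhb' hbd
    have h1 : (d - h) * B ≤ (d - h) * freeBdGGain tp n b := mul_le_mul_of_nonneg_left hB (by linarith)
    have h2 : (b - h) * freeBdGGain tp n d ≤ (b - h) * D := mul_le_mul_of_nonneg_left hD (by linarith)
    linarith

end Literature.MathematicalPhysics.QuantumLattice

end
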